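import Summits.QuantumFields.BalabanUV.Beta.RoadP2Chain
import Summits.QuantumFields.BalabanUV.Beta.CutoffVariant316

/-!
# Beta / RoadP2End — BINDER-OWNERS row D4, co-owner road P2′: the wall END with the smallness function LITERALLY the
# (3.16)/(3.30) budget `A(g) = g·(c_I r(g)³ + c_E r(g)) + c_χ e^{−λ r(g)²}`, `r(g) = A₁(log g⁻²)^{p₀}` — nodes C and D composed
# BY NAME (β sub-cell, unit `b2b-balaban-beta-d4-p2`, generation 1; `HOME/beta/skeletons/D4-b2b-balaban-beta-d4-p2.md` §2 END)

HONEST FRAMING (page 1 of everything the β sub-cell writes): discharging `BetaPertH` makes Bałaban's UV stability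
UNCONDITIONAL — a real constructive-QFT result; it is NOT the continuum limit and NOT the Clay problem.  HONEST DEPENDENCY
(cell reorg 2026-08-19, verbatim): «continuum YM on T⁴ ⇐ BetaPertH ∧ nine spine estimates (0/9 proved); BetaPertH ⇐ (D1) ∧
(D4) ∧ CAP+tail; G-an2-4 gates asym, D1 and NE2/3/4.»  THIS MODULE INSTANTIATES NO BINDER: it composes the co-owner's
`RoadP2Chain.endpointExistence_of_chainVarT` (the variable-budget remainder chain ⟹ the wall's `EndpointExistence`, NO
`r ≤ b`) with `CutoffVariant316.budget_nonneg` / `budget_monotoneOn` / `tendsto_budget` (the budget of the cut-off variant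
is non-negative, monotone on `]0, e^{−3p₀}]` and → 0 at 0⁺), discharging the END's three analytic hypotheses on the
smallness function `A`.  What is LEFT displayed is exactly the road's located residue: the torus chain `ChainVarT` with
activity `budget(g_k)` (its `PolLeavesT118` leaves = apex A′ + NODE O + χ.4, OPEN-IN-PRINT / unowned), the printed sign and
rate conditions, `γ₀ ≤ e^{−3p₀}`, the one-loop drift (rows D1/CAP) and continuity (row hcont).

ABSOLUTE RULE (cell charter, verbatim): "No internally-minted statement may enter as a cited fact. Every hypothesis is
either kernel-proved in this package or a verbatim quotation of a PUBLISHED theorem with page reference. The manuscript(s)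
under audit are NOT citable for their own disputed steps — they are the thing under adjudication; programme-internal
(2001/route/tribunal) claims are never citable."  Nothing is cited as a fact here.
-/

namespace Summit.QuantumFields.BalabanUV.Beta.RoadP2End

open Literature.MathematicalPhysics.QuantumFieldTheory.Balaban1983to89
open FlowStep DagBinding FlowStepRuns
open Literature.MathematicalPhysics.QuantumFieldTheory.Balaban1983to89.B12TreeDecay (kappa₀ K₀ K₀_pos)
open Literature.MathematicalPhysics.QuantumFieldTheory.Balaban1983to89.Beta.RemainderChain
open Literature.MathematicalPhysics.QuantumFieldTheory.Balaban1983to89.Beta.Drift (OneLoopDrift)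
open Literature.MathematicalPhysics.QuantumFieldTheory.Balaban1983to89.Beta.DriftRemainder
open Summit.QuantumFields.BalabanUV.Beta.RoadP2Chain
open Summit.QuantumFields.BalabanUV.Beta.CutoffVariant316
open Metric Filter Topology Set

noncomputable section

variable {d : ℕ}

/-- **ROAD P2′ — THE WALL END WITH THE (3.16)/(3.30) BUDGET.**  A torus remainder chain whose level-k activity is
`budget c_I c_E c_χ λ A₁ p₀ (g_k)` (node C: `g·(c_I r³ + c_E r)` = the g_k·⟨insertion⟩ part of (3.30) with the cubic/linear
insertion bounds at the cut-off radius `r = r(g)` of (3.16), `c_χ e^{−λr²}` = the cut-off term), with non-negative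
constants, `λ, A₁ > 0`, `p₀ ≥ 1`, history box `γ₀ ≤ e^{−3p₀}`, the printed sign/rate conditions, the one-loop drift with
`b > 0` and continuity, GIVES the wall's `EndpointExistence` — by `endpointExistence_of_chainVarT` with its hypotheses
`hact` / `hmono` / `hA` discharged by `budget_nonneg` / `budget_monotoneOn` / `tendsto_budget`.  NO `r ≤ b`, NO N3. -/
theorem endpointExistence_of_budgetChainT {M : ℕ} [NeZero M] {C : B12.Construction} {β : HBeta}
    (hgen : ForwardGenerated C β) (S : B12Beta.OneLoopSplit β) {μ ν : Fin d} {γ₀ b Adr : ℝ}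
    {cI cE cχ lam A₁ : ℝ} {p₀ : ℕ} {κ δ₀ α₂ B₃ : ℝ}
    (R : ChainVarT d M μ ν S γ₀ (budget cI cE cχ lam A₁ p₀) κ δ₀ α₂ B₃)
    (hcI : 0 ≤ cI) (hcE : 0 ≤ cE) (hcχ : 0 ≤ cχ) (hlam : 0 < lam) (hA₁ : 0 < A₁) (hp₀ : 1 ≤ p₀)
    (hγ₀p : γ₀ ≤ Real.exp (-(3 * (p₀ : ℝ))))
    (hα₂ : 0 < α₂) (hB₃ : 0 ≤ B₃) (hδ₀ : 0 < δ₀) (htree : kappa₀ (4 * 2 ^ d) (2 * d) ≤ κ / 2) (hd : 0 < d)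
    (hγ₀ : 0 < γ₀) (hb : 0 < b) (hdrift : OneLoopDrift b Adr S.β0) (hcont : BetaContH γ₀ β) :
    EndpointExistence C := by
  obtain ⟨h31, h11⟩ := exp_neg_three_le p₀
  have hγ₀1 : γ₀ ≤ 1 := hγ₀p.trans (h31.trans h11)
  have hact : ∀ g, 0 < g → g ≤ γ₀ → 0 ≤ budget cI cE cχ lam A₁ p₀ g := fun g hg hgγ =>
    budget_nonneg hcI hcE hcχ hA₁.le p₀ hg (hgγ.trans hγ₀1)
  have hmono : MonotoneOn (budget cI cE cχ lam A₁ p₀) (Ioc 0 γ₀) :=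
    (budget_monotoneOn hcI hcE hcχ hlam.le hA₁.le p₀).mono (Ioc_subset_Ioc le_rfl hγ₀p)
  exact endpointExistence_of_chainVarT hgen S R hact hmono (tendsto_budget cI cE cχ hlam hA₁ hp₀) hα₂ hB₃ hδ₀ htree
    hd hγ₀ hb hdrift hcont

end

end Summit.QuantumFields.BalabanUV.Beta.RoadP2End
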